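import Mathlib
import Summits.NavierStokesRegularity.NavierStokesRegularity.Theorems.L3TimeExponentPincerRingDatumFrame
import Summits.NavierStokesRegularity.NavierStokesRegularity.Theorems.L3TimeExponentPincerRingDatumProfile
import Literature.Analysis.FluidPDE.VorticityCalculus
import HarnessLib.Audit
import HarnessLib

/-!
# L3TimeExponentPincer — ring datum calculus V: `ω_θ/r` of the glued-dipole ring datum

Support kernel for the crux `L3CascadeJaw` (item stmt-NavierStokesRegularity-19499).  Combines
`angVortQuot_ringField` (`ω_θ/r = −(4sF'' + 10F')(|x|²)` for `u₀ = curl (F(|x|²) J)`) with the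
profile design `F' = F₁ = s^{-5/2} G` of `L3TimeExponentPincerRingDatumProfile`:

* `angVortQuot_ringField_eq` — off the origin `η₀(x) = −4 (|x|²)^{-3/2} G'(|x|²)`;
* `angVortQuot_ringField_eq_zero` — `η₀ = 0` on `|x|² < a` when `G = 0` below `a`;
* `abs_angVortQuot_ringField_le` — the sup bound `|η₀| ≤ 4 a^{-3/2} D` (`|G'| ≤ D`), i.e. the
  constant `M` of `lpPersistence_of_ringData`;
* `angVortQuot_ringField_nonneg/nonpos` — the sign of `η₀` is the sign of `−G'`;
* `continuous_angVortQuot_ringField`, `angVortQuot_ringField_eq_zero_of_lt`,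
  `integrable_angVortQuot_ringField` — `η₀` is continuous, vanishes on `|x|² > R` when `F` does,
  hence is integrable (hypothesis `Integrable (angVortQuot u₀)` of `lpPersistence_of_ringData`).

WHAT THIS IS NOT: pure calculus; no fluid statement.
-/

namespace Summit.NavierStokesRegularity.NavierStokesRegularity.Theorems.L3TimeExponentPincerRingDatumEta

open Real Set Metric MeasureTheory Literature.Analysis.FluidPDE
open Summit.NavierStokesRegularity.NavierStokesRegularity.Theorems.L3TimeExponentPincerRingDatumVorticity
open Summit.NavierStokesRegularity.NavierStokesRegularity.Theorems.L3TimeExponentPincerRingDatumProfile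
open Summit.NavierStokesRegularity.NavierStokesRegularity.Theorems.L3TimeExponentPincerRingDatumFrame
open scoped ContDiff Topology

variable {F G : ℝ → ℝ} {a R D : ℝ}

/-- **`ω_θ/r` off the origin**: if `F' = s^{-5/2} G` then
`η₀(x) = −4 (|x|²)^{-3/2} G'(|x|²)` for `x ≠ 0`. -/
theorem angVortQuot_ringField_eq (hF : ContDiff ℝ 4 F)
    (hF' : deriv F = fun s => s ^ (-(5 / 2 : ℝ)) * G s) (hG : Differentiable ℝ G)
    {x : EuclideanSpace ℝ (Fin 3)} (hx : x ≠ 0) :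
    angVortQuot (curl fun y : EuclideanSpace ℝ (Fin 3) => F (‖y‖ ^ 2) • rotGen y) x =
      -(4 * (‖x‖ ^ 2) ^ (-(3 / 2 : ℝ)) * deriv G (‖x‖ ^ 2)) := by
  have hs : 0 < ‖x‖ ^ 2 := by positivity
  rw [angVortQuot_ringField hF, hF']
  beta_reduce
  rw [four_mul_deriv_rpowProfile_add hG hs]

/-- **`ω_θ/r` vanishes in the core hole**: if `G = 0` on `(−∞, a]` then `η₀(x) = 0` for `|x|² < a`. -/
theorem angVortQuot_ringField_eq_zero (hF : ContDiff ℝ 4 F)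
    (hF' : deriv F = fun s => s ^ (-(5 / 2 : ℝ)) * G s) (hGa : ∀ s, s ≤ a → G s = 0)
    {x : EuclideanSpace ℝ (Fin 3)} (hx : ‖x‖ ^ 2 < a) :
    angVortQuot (curl fun y : EuclideanSpace ℝ (Fin 3) => F (‖y‖ ^ 2) • rotGen y) x = 0 := by
  rw [angVortQuot_ringField hF, hF']
  beta_reduce
  rw [deriv_rpowProfile_eq_zero hGa hx, rpowProfile_eq_zero hGa hx.le]
  ring

/-- **Sup bound** (the constant `M`): if `G = 0` on `(−∞, a]` (`a > 0`) and `|G'| ≤ D` then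
`|η₀(x)| ≤ 4 a^{-3/2} D` for every `x`. -/
theorem abs_angVortQuot_ringField_le (hF : ContDiff ℝ 4 F)
    (hF' : deriv F = fun s => s ^ (-(5 / 2 : ℝ)) * G s) (hG : Differentiable ℝ G) (ha : 0 < a)
    (hGa : ∀ s, s ≤ a → G s = 0) (hD : ∀ s, |deriv G s| ≤ D) (x : EuclideanSpace ℝ (Fin 3)) :
    |angVortQuot (curl fun y : EuclideanSpace ℝ (Fin 3) => F (‖y‖ ^ 2) • rotGen y) x| ≤
      4 * a ^ (-(3 / 2 : ℝ)) * D := by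
  have hD0 : 0 ≤ D := (abs_nonneg _).trans (hD 0)
  rcases lt_or_ge (‖x‖ ^ 2) a with hx | hx
  · rw [angVortQuot_ringField_eq_zero hF hF' hGa hx, abs_zero]
    positivity
  · have hx0 : x ≠ 0 := by
      intro h0; rw [h0, norm_zero] at hx; norm_num at hx; linarith
    rw [angVortQuot_ringField_eq hF hF' hG hx0, abs_neg, abs_mul, abs_mul,
      abs_of_nonneg (by norm_num : (0 : ℝ) ≤ 4), abs_of_nonneg (Real.rpow_nonneg (sq_nonneg _) _)]
    have h1 : (‖x‖ ^ 2) ^ (-(3 / 2 : ℝ)) ≤ a ^ (-(3 / 2 : ℝ)) :=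
      Real.rpow_le_rpow_of_nonpos ha hx (by norm_num)
    have h2 : 0 ≤ (‖x‖ ^ 2) ^ (-(3 / 2 : ℝ)) := Real.rpow_nonneg (sq_nonneg _) _
    calc 4 * (‖x‖ ^ 2) ^ (-(3 / 2 : ℝ)) * |deriv G (‖x‖ ^ 2)|
        ≤ 4 * a ^ (-(3 / 2 : ℝ)) * D := by
          gcongr
          exact hD _

/-- **Sign, positive side**: where `G'(|x|²) ≤ 0` one has `η₀(x) ≥ 0`. -/
theorem angVortQuot_ringField_nonneg (hF : ContDiff ℝ 4 F)
    (hF' : deriv F = fun s => s ^ (-(5 / 2 : ℝ)) * G s) (hG : Differentiable ℝ G)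
    {x : EuclideanSpace ℝ (Fin 3)} (hx : x ≠ 0) (hG' : deriv G (‖x‖ ^ 2) ≤ 0) :
    0 ≤ angVortQuot (curl fun y : EuclideanSpace ℝ (Fin 3) => F (‖y‖ ^ 2) • rotGen y) x := by
  rw [angVortQuot_ringField_eq hF hF' hG hx]
  have h2 : 0 ≤ (‖x‖ ^ 2) ^ (-(3 / 2 : ℝ)) := Real.rpow_nonneg (sq_nonneg _) _
  nlinarith [mul_nonneg h2 (neg_nonneg.2 hG')]

/-- **Sign, negative side**: where `G'(|x|²) ≥ 0` one has `η₀(x) ≤ 0`. -/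
theorem angVortQuot_ringField_nonpos (hF : ContDiff ℝ 4 F)
    (hF' : deriv F = fun s => s ^ (-(5 / 2 : ℝ)) * G s) (hG : Differentiable ℝ G)
    {x : EuclideanSpace ℝ (Fin 3)} (hx : x ≠ 0) (hG' : 0 ≤ deriv G (‖x‖ ^ 2)) :
    angVortQuot (curl fun y : EuclideanSpace ℝ (Fin 3) => F (‖y‖ ^ 2) • rotGen y) x ≤ 0 := by
  rw [angVortQuot_ringField_eq hF hF' hG hx]
  have h2 : 0 ≤ (‖x‖ ^ 2) ^ (-(3 / 2 : ℝ)) := Real.rpow_nonneg (sq_nonneg _) _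
  nlinarith [mul_nonneg h2 hG']

/-! ### Continuity, support and integrability of `ω_θ/r` (no profile structure needed) -/

/-- `ω_θ/r` of the ring field is the continuous radial function `−(4sF'' + 10F')(|x|²)`. -/
theorem continuous_angVortQuot_ringField (hF : ContDiff ℝ 4 F) :
    Continuous (angVortQuot (curl fun y : EuclideanSpace ℝ (Fin 3) => F (‖y‖ ^ 2) • rotGen y)) := by
  have e : angVortQuot (curl fun y : EuclideanSpace ℝ (Fin 3) => F (‖y‖ ^ 2) • rotGen y) =
      fun x => -(4 * ‖x‖ ^ 2 * deriv (deriv F) (‖x‖ ^ 2) + 10 * deriv F (‖x‖ ^ 2)) :=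
    funext (angVortQuot_ringField hF)
  rw [e]
  have h1 : Continuous (deriv F) := hF.continuous_deriv (by norm_num)
  have h2 : Continuous (deriv (deriv F)) := by
    have h' : ContDiff ℝ 3 (deriv F) := ContDiff.deriv' (n := 3) (by exact_mod_cast hF)
    exact h'.continuous_deriv (by norm_num)
  have hn : Continuous fun x : EuclideanSpace ℝ (Fin 3) => ‖x‖ ^ 2 := (continuous_norm).pow 2
  exact ((continuous_const.mul hn).mul (h2.comp hn)).add (continuous_const.mul (h1.comp hn)) |>.neg

/-- If `F = 0` on `[R, ∞)` then `η₀(x) = 0` for `|x|² > R`. -/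
theorem angVortQuot_ringField_eq_zero_of_lt (hF : ContDiff ℝ 4 F) (hF0 : ∀ s, R ≤ s → F s = 0)
    {x : EuclideanSpace ℝ (Fin 3)} (hx : R < ‖x‖ ^ 2) :
    angVortQuot (curl fun y : EuclideanSpace ℝ (Fin 3) => F (‖y‖ ^ 2) • rotGen y) x = 0 := by
  rw [angVortQuot_ringField hF]
  have hd : ∀ s, R < s → deriv F s = 0 := by
    intro s hs
    have hev : F =ᶠ[𝓝 s] fun _ => (0 : ℝ) := by
      filter_upwards [Ioi_mem_nhds hs] with t ht using hF0 t (le_of_lt ht)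
    rw [hev.deriv_eq, deriv_const]
  have hdd : deriv (deriv F) (‖x‖ ^ 2) = 0 := by
    have hev : deriv F =ᶠ[𝓝 (‖x‖ ^ 2)] fun _ => (0 : ℝ) := by
      filter_upwards [Ioi_mem_nhds hx] with t ht using hd t ht
    rw [hev.deriv_eq, deriv_const]
  rw [hdd, hd _ hx]
  ring

/-- If `F = 0` on `[R, ∞)` (`0 ≤ R`) then `η₀` is supported in the closed ball of radius `√R`. -/
theorem support_angVortQuot_ringField_subset (hF : ContDiff ℝ 4 F) (hR : 0 ≤ R)
    (hF0 : ∀ s, R ≤ s → F s = 0) :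
    Function.support (angVortQuot (curl fun y : EuclideanSpace ℝ (Fin 3) => F (‖y‖ ^ 2) • rotGen y)) ⊆
      closedBall (0 : EuclideanSpace ℝ (Fin 3)) (Real.sqrt R) := by
  intro y hy
  rw [mem_closedBall, dist_zero_right]
  by_contra h
  rw [not_le] at h
  have h2 : R < ‖y‖ ^ 2 := by
    have hs : Real.sqrt R ^ 2 = R := Real.sq_sqrt hR
    nlinarith [Real.sqrt_nonneg R, norm_nonneg y]
  exact hy (angVortQuot_ringField_eq_zero_of_lt hF hF0 h2)

/-- **Integrability of `ω_θ/r`** of the ring datum (hypothesis `Integrable (angVortQuot u₀)` of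
`lpPersistence_of_ringData`): continuous with compact support. -/
theorem integrable_angVortQuot_ringField (hF : ContDiff ℝ 4 F) (hR : 0 ≤ R)
    (hF0 : ∀ s, R ≤ s → F s = 0) :
    Integrable (angVortQuot (curl fun y : EuclideanSpace ℝ (Fin 3) => F (‖y‖ ^ 2) • rotGen y)) :=
  (continuous_angVortQuot_ringField hF).integrable_of_hasCompactSupport
    (HasCompactSupport.of_support_subset_isCompact (isCompact_closedBall 0 (Real.sqrt R))
      (support_angVortQuot_ringField_subset hF hR hF0))

end Summit.NavierStokesRegularity.NavierStokesRegularity.Theorems.L3TimeExponentPincerRingDatumEta
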